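import Literature.AnabelianGeometry.SemiGraphs.CoveringOfObjectVertexAligned
import HarnessLib

/-!
# Level branches of the covering `𝒢_A → 𝒢`: the diagonal endomorphism on EDGE fibres ([SemiAnbd] §2)

Mochizuki, *Semi-graphs of anabelioids*, Publ. RIMS **42** (2006) 221–322, §2, Definition 2.2 (i)
p. 23 (the covering `𝒢_A → 𝒢` attached to `A ∈ B(𝒢)`: "the vertices (respectively, edges) of `𝔾′`
that lie over a vertex `v` (respectively, edge `e`) correspond to connected components of `S_v`
(respectively, `T_e`)") and Remark 2.2.1 p. 24 ("the image of each `Π_v` (respectively, `Π_b`) in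
`Π_𝒢` is equal to the stabilizer of a compatible system of vertices (respectively, edges)")
[cite: MochizukiSemiAnbd2006, Rem. 2.2.1 p.24].

PROOF-ONLY file (abc-iut cell, layer L3, row F-1477 / [SemiAnbd] Rmk. 2.10.1 `remark_2_10_1`,
sub-node (L4b-dict) "transported branch groups of the level covering"; seat abc-iut-w5-d186,
holder/assembler abc-iut-L3-t12, co-worker abc-iut-L6-t18).  It extends abc-iut's
`CoveringOfObjectVertexAligned.lean` (the tautological point of `φ^* A` through a level VERTEX) to
the EDGE constituents of `𝒢_A`:

* `exists_pullbackObj_diagEndo₂` — the diagonal endomorphism `d` of `φ^* A ∈ B(𝒢_A)` of that file,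
  re-run with BOTH its vertex components `(p, s) ↦ (p, p)` on `P × S_v → P` and its edge components
  `(q, t) ↦ (q, q)` on `Q × T_e → Q` recorded (the tree's `exists_pullbackObj_diagEndo` records only
  the vertex components; the proof is the same core chase `gluingFunctor_map_diag`);
* `map_diagEndo_fT_apply` — on the fibre of the edge object of `φ^* A` at a level edge `(e, Q)` the
  endomorphism acts as the CONSTANT map with value the edge tautological point
  `a‴ = F_Q((q ↦ (q, q)))(t)`, which lies in the sub-fibre `F_Q(Q × Q → Q) ↪ F_Q(Q × T_e → Q)`
  (`diagPointE_mem_range`);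
* `map_ψ_diagPoint` — along a level branch `(b, Q)` abutting to `(v, P)`, the gluing isomorphism
  `ψ̃` of `φ^* A` carries (the `α̃`-transport of) the vertex tautological point `a″` to the edge
  tautological point `a‴` (naturality of `d` with respect to `ψ̃` = the `comm` field of `d`).

These are the "pinning" inputs of `LevelBranchGroupsDictionary.lean`.  No statement here takes a
side on any disputed claim; nothing about [IUTchIII] Cor. 3.12.
-/

namespace Literature.AnabelianGeometry.SemiGraphs

open CategoryTheory CategoryTheory.Limits CategoryTheory.Functor CategoryTheory.PreGaloisCategory
open Literature.AnabelianGeometry.Anabelioids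
open scoped Pointwise

universe v₁ u₁ u

namespace SemiGraphOfAnabelioids

namespace BObj

variable {𝒢 : SemiGraphOfAnabelioids.{v₁, u₁, u}} (A : 𝒢.BObj)

set_option backward.isDefEq.respectTransparency false

/-! ### A. The diagonal endomorphism with its edge components -/

/-- **The diagonal endomorphism of `φ^* A` in `B(𝒢_A)`, vertex AND edge components recorded**:
there is an endomorphism `d` of `φ^* A` whose component at the level vertex `(v, P)` is (the model of)
`(p, s) ↦ (p, p)` on `P × S_v → P` and whose component at the level edge `(e, Q)` is (the model of)
`(q, t) ↦ (q, q)` on `Q × T_e → Q`; compatibility with the gluing isomorphisms of `φ^* A` is the core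
chase `gluingFunctor_map_diag` (as in `exists_pullbackObj_diagEndo`, whose proof this re-runs).
[cite: MochizukiSemiAnbd2006, Def. 2.2(i) p.23] -/
theorem exists_pullbackObj_diagEndo₂ :
    ∃ d : A.coveringHom.pullbackFunctor.obj A ⟶ A.coveringHom.pullbackFunctor.obj A,
      (∀ vc : A.fibreData.total.Vertex,
        d.fS vc = (Shrink.equivalence
            (Over ((A.vComp vc).1 : 𝒢.V (A.fibreData.proj.vertexMap vc)))).functor.map
          (Over.homMk (prod.lift prod.fst (prod.fst ≫ (A.vComp vc).1.arrow)) (by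
              change prod.lift prod.fst (prod.fst ≫ _) ≫ (prod.lift prod.fst (𝟙 _) ≫ prod.fst) =
                prod.lift prod.fst (𝟙 _) ≫ prod.fst
              rw [prod.lift_fst, prod.lift_fst]) :
            (Over.star ((A.vComp vc).1 : 𝒢.V (A.fibreData.proj.vertexMap vc))).obj
                (A.S (A.fibreData.proj.vertexMap vc)) ⟶
              (Over.star ((A.vComp vc).1 : 𝒢.V (A.fibreData.proj.vertexMap vc))).obj
                (A.S (A.fibreData.proj.vertexMap vc)))) ∧
      ∀ ec : A.fibreData.total.Edge,
        d.fT ec = (Shrink.equivalence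
            (Over ((A.eComp ec).1 : 𝒢.E (A.fibreData.proj.edgeMap ec)))).functor.map
          (Over.homMk (prod.lift prod.fst (prod.fst ≫ (A.eComp ec).1.arrow)) (by
              change prod.lift prod.fst (prod.fst ≫ _) ≫ (prod.lift prod.fst (𝟙 _) ≫ prod.fst) =
                prod.lift prod.fst (𝟙 _) ≫ prod.fst
              rw [prod.lift_fst, prod.lift_fst]) :
            (Over.star ((A.eComp ec).1 : 𝒢.E (A.fibreData.proj.edgeMap ec))).obj
                (A.T (A.fibreData.proj.edgeMap ec)) ⟶
              (Over.star ((A.eComp ec).1 : 𝒢.E (A.fibreData.proj.edgeMap ec))).obj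
                (A.T (A.fibreData.proj.edgeMap ec))) := by
  let δS : ∀ vc : A.fibreData.total.Vertex,
      (Over.star ((A.vComp vc).1 : 𝒢.V (A.fibreData.proj.vertexMap vc))).obj
          (A.S (A.fibreData.proj.vertexMap vc)) ⟶
        (Over.star ((A.vComp vc).1 : 𝒢.V (A.fibreData.proj.vertexMap vc))).obj
          (A.S (A.fibreData.proj.vertexMap vc)) :=
    fun vc => Over.homMk (prod.lift prod.fst (prod.fst ≫ (A.vComp vc).1.arrow)) (by
      change prod.lift prod.fst (prod.fst ≫ _) ≫ (prod.lift prod.fst (𝟙 _) ≫ prod.fst) =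
        prod.lift prod.fst (𝟙 _) ≫ prod.fst
      rw [prod.lift_fst, prod.lift_fst])
  let δT : ∀ ec : A.fibreData.total.Edge,
      (Over.star ((A.eComp ec).1 : 𝒢.E (A.fibreData.proj.edgeMap ec))).obj
          (A.T (A.fibreData.proj.edgeMap ec)) ⟶
        (Over.star ((A.eComp ec).1 : 𝒢.E (A.fibreData.proj.edgeMap ec))).obj
          (A.T (A.fibreData.proj.edgeMap ec)) :=
    fun ec => Over.homMk (prod.lift prod.fst (prod.fst ≫ (A.eComp ec).1.arrow)) (by
      change prod.lift prod.fst (prod.fst ≫ _) ≫ (prod.lift prod.fst (𝟙 _) ≫ prod.fst) =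
        prod.lift prod.fst (𝟙 _) ≫ prod.fst
      rw [prod.lift_fst, prod.lift_fst])
  refine ⟨⟨fun vc => (Shrink.equivalence
      (Over ((A.vComp vc).1 : 𝒢.V (A.fibreData.proj.vertexMap vc)))).functor.map (δS vc),
    fun ec => (Shrink.equivalence
      (Over ((A.eComp ec).1 : 𝒢.E (A.fibreData.proj.edgeMap ec)))).functor.map (δT ec), ?_⟩,
    fun vc => rfl, fun ec => rfl⟩
  intro bc vc h
  -- names for the data at the branch `(b, Q)` abutting to `(v, P)`
  let v := A.fibreData.proj.vertexMap vc
  let b := A.fibreData.proj.branchMap bc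
  have h₀ : 𝒢.graph.abuts b = some v := abuts_fst h
  let P : Subobject (A.S v) := (A.vComp vc).1
  let Q : Subobject (A.T (𝒢.graph.edgeOf b)) := (A.brComp bc).1
  have hle : Q ≤ A.branchImage b v h₀ P := brComp_le_branchImage h
  let eP := Shrink.equivalence (Over (P : 𝒢.V v))
  let eQ := Shrink.equivalence (Over (Q : 𝒢.E (𝒢.graph.edgeOf b)))
  let G := A.gluingFunctor h₀ P Q hle
  have hψ₁ : ((A.coveringHom.pullbackFunctor.obj A).ψ bc vc h).hom =
      (A.coveringHom.φB bc vc h).hom.app (A.S v) ≫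
        (A.coveringHom.φE _ _ (A.fibreData.proj.edgeOf_branchMap bc).symm).pullback.map
          (A.ψ b v (A.fibreData.proj.abuts_branchMap bc vc h)).hom ≫
        (A.coveringHom.reindexIso (A.fibreData.total.edgeOf bc) _ _
          (A.fibreData.proj.edgeOf_branchMap bc).symm rfl).hom.app A := rfl
  have hψ₂ : (A.coveringHom.reindexIso (A.fibreData.total.edgeOf bc) _ _
          (A.fibreData.proj.edgeOf_branchMap bc).symm rfl).hom.app A = 𝟙 _ := by
    simp [Hom.reindexIso]
  have hψ₃ : (A.coveringHom.φB bc vc h).hom.app (A.S v) =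
      eQ.functor.map (G.map (eP.unitIso.inv.app ((Over.star (P : 𝒢.V v)).obj (A.S v)))) ≫
        eQ.functor.map ((A.gluingStarIso h₀ P Q hle).hom.app (A.S v)) := rfl
  have hψ₄ : (A.coveringHom.φE _ _ (A.fibreData.proj.edgeOf_branchMap bc).symm).pullback.map
          (A.ψ b v (A.fibreData.proj.abuts_branchMap bc vc h)).hom =
      eQ.functor.map ((Over.star (Q : 𝒢.E (𝒢.graph.edgeOf b))).map (A.ψ b v h₀).hom) := rfl
  have hpull : (A.coveringGraph.pull bc vc h).pullback.map
        ((Shrink.equivalence (Over (Subobject.underlying.obj (A.vComp vc).1))).functor.map (δS vc)) =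
      eQ.functor.map (G.map (eP.inverse.map (eP.functor.map (δS vc)))) := rfl
  have hT : (Shrink.equivalence (Over (Subobject.underlying.obj
          (A.eComp (A.coveringGraph.graph.edgeOf bc)).1))).functor.map (δT (A.coveringGraph.graph.edgeOf bc)) =
      eQ.functor.map (Over.homMk (prod.lift prod.fst (prod.fst ≫ Q.arrow)) (by
        change prod.lift prod.fst (prod.fst ≫ _) ≫ (prod.lift prod.fst (𝟙 _) ≫ prod.fst) =
          prod.lift prod.fst (𝟙 _) ≫ prod.fst
        rw [prod.lift_fst, prod.lift_fst]) :
          (Over.star (Q : 𝒢.E (𝒢.graph.edgeOf b))).obj (A.T (𝒢.graph.edgeOf b)) ⟶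
            (Over.star (Q : 𝒢.E (𝒢.graph.edgeOf b))).obj (A.T (𝒢.graph.edgeOf b))) := rfl
  -- unit naturality and the core chase, in `(𝒢_e)_{/Q}`
  have nat : eP.inverse.map (eP.functor.map (δS vc)) ≫
        eP.unitIso.inv.app ((Over.star (P : 𝒢.V v)).obj (A.S v)) =
      eP.unitIso.inv.app ((Over.star (P : 𝒢.V v)).obj (A.S v)) ≫ δS vc :=
    eP.unitIso.inv.naturality (δS vc)
  have core : G.map (δS vc) ≫ (A.gluingStarIso h₀ P Q hle).hom.app (A.S v) ≫
        (Over.star (Q : 𝒢.E (𝒢.graph.edgeOf b))).map (A.ψ b v h₀).hom =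
      (A.gluingStarIso h₀ P Q hle).hom.app (A.S v) ≫
        (Over.star (Q : 𝒢.E (𝒢.graph.edgeOf b))).map (A.ψ b v h₀).hom ≫
          (Over.homMk (prod.lift prod.fst (prod.fst ≫ Q.arrow)) (by
            change prod.lift prod.fst (prod.fst ≫ _) ≫ (prod.lift prod.fst (𝟙 _) ≫ prod.fst) =
              prod.lift prod.fst (𝟙 _) ≫ prod.fst
            rw [prod.lift_fst, prod.lift_fst]) :
          (Over.star (Q : 𝒢.E (𝒢.graph.edgeOf b))).obj (A.T (𝒢.graph.edgeOf b)) ⟶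
            (Over.star (Q : 𝒢.E (𝒢.graph.edgeOf b))).obj (A.T (𝒢.graph.edgeOf b))) :=
    A.gluingFunctor_map_diag h₀ P Q hle
  rw [hpull, hψ₁, hψ₂, hψ₃, hψ₄, hT]
  erw [Category.comp_id]
  simp only [Category.assoc, ← Functor.map_comp]
  congr 1
  rw [← G.map_comp_assoc, nat, G.map_comp_assoc, core]

/-! ### B. The tautological point of `φ^* A` at a level EDGE -/

/-- The one-point fibre `F_Q(Q = Q)` (terminal object of `(𝒢_e)_{/Q}`, in the model) is inhabited.
[cite: MochizukiSemiAnbd2006, Rem. 2.2.1 p.24] -/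
theorem nonempty_fiber_mkId_E (ec : A.fibreData.total.Edge)
    (G' : A.coveringGraph.E ec ⥤ FintypeCat.{v₁}) [FiberFunctor G'] :
    Nonempty (G'.obj ((Shrink.equivalence (Over ((A.eComp ec).1 : 𝒢.E (A.fibreData.proj.edgeMap ec)))).functor.obj
      (Over.mk (𝟙 ((A.eComp ec).1 : 𝒢.E (A.fibreData.proj.edgeMap ec)))))) := by
  haveI : GaloisCategory (Shrink.{u₁} (Over ((A.eComp ec).1 : 𝒢.E (A.fibreData.proj.edgeMap ec)))) :=
    A.galoisCategory_eModel ec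
  have hT := Over.mkIdTerminal.isTerminalObj
    (Shrink.equivalence (Over ((A.eComp ec).1 : 𝒢.E (A.fibreData.proj.edgeMap ec)))).functor
    (Over.mk (𝟙 ((A.eComp ec).1 : 𝒢.E (A.fibreData.proj.edgeMap ec))))
  obtain ⟨eqv⟩ := nonempty_equiv_fiber_terminal_punit G'
  exact ⟨G'.map (hT.uniqueUpToIso terminalIsTerminal).inv (eqv.symm PUnit.unit)⟩

/-- **The diagonal endomorphism acts on EDGE fibres as a CONSTANT map** with value the edge
tautological point `a‴ = F_Q((q ↦ (q, q)) : (Q = Q) → (Q × T_e → Q))(t)`: the idempotent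
`(q, t) ↦ (q, q)` factors through the terminal object `Q = Q` of `(𝒢_e)_{/Q}`, whose fibre is a
single point (edge twin of `map_diagEndo_fS_apply`). [cite: MochizukiSemiAnbd2006, Rem. 2.2.1 p.24] -/
theorem map_diagEndo_fT_apply
    (d : A.coveringHom.pullbackFunctor.obj A ⟶ A.coveringHom.pullbackFunctor.obj A)
    (hd : ∀ ec : A.fibreData.total.Edge,
        d.fT ec = (Shrink.equivalence
            (Over ((A.eComp ec).1 : 𝒢.E (A.fibreData.proj.edgeMap ec)))).functor.map
          (Over.homMk (prod.lift prod.fst (prod.fst ≫ (A.eComp ec).1.arrow)) (by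
              change prod.lift prod.fst (prod.fst ≫ _) ≫ (prod.lift prod.fst (𝟙 _) ≫ prod.fst) =
                prod.lift prod.fst (𝟙 _) ≫ prod.fst
              rw [prod.lift_fst, prod.lift_fst]) :
            (Over.star ((A.eComp ec).1 : 𝒢.E (A.fibreData.proj.edgeMap ec))).obj
                (A.T (A.fibreData.proj.edgeMap ec)) ⟶
              (Over.star ((A.eComp ec).1 : 𝒢.E (A.fibreData.proj.edgeMap ec))).obj
                (A.T (A.fibreData.proj.edgeMap ec))))
    (ec : A.fibreData.total.Edge) (G' : A.coveringGraph.E ec ⥤ FintypeCat.{v₁}) [FiberFunctor G']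
    (t : G'.obj ((Shrink.equivalence (Over ((A.eComp ec).1 : 𝒢.E (A.fibreData.proj.edgeMap ec)))).functor.obj
      (Over.mk (𝟙 ((A.eComp ec).1 : 𝒢.E (A.fibreData.proj.edgeMap ec))))))
    (z : G'.obj ((A.coveringHom.pullbackFunctor.obj A).T ec)) :
    G'.map (d.fT ec) z =
      G'.map ((Shrink.equivalence (Over ((A.eComp ec).1 : 𝒢.E (A.fibreData.proj.edgeMap ec)))).functor.map
          ((Over.forgetAdjStar ((A.eComp ec).1 : 𝒢.E (A.fibreData.proj.edgeMap ec))).unit.app (Over.mk (𝟙 _)) ≫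
            (Over.star ((A.eComp ec).1 : 𝒢.E (A.fibreData.proj.edgeMap ec))).map (A.eComp ec).1.arrow)) t := by
  -- notation
  let f := A.fibreData.proj.edgeMap ec
  let Q : Subobject (A.T f) := (A.eComp ec).1
  let eQ := Shrink.equivalence (Over (Q : 𝒢.E f))
  let η : Over.mk (𝟙 (Q : 𝒢.E f)) ⟶ (Over.star (Q : 𝒢.E f)).obj (Q : 𝒢.E f) :=
    (Over.forgetAdjStar (Q : 𝒢.E f)).unit.app (Over.mk (𝟙 _))
  let τ : (Over.star (Q : 𝒢.E f)).obj (A.T f) ⟶ Over.mk (𝟙 (Q : 𝒢.E f)) :=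
    Over.homMk prod.fst (by
      change prod.fst ≫ 𝟙 _ = prod.lift prod.fst (𝟙 _) ≫ prod.fst
      rw [prod.lift_fst, Category.comp_id])
  -- the diagonal idempotent factors through the terminal object `Q = Q` of `(𝒢_e)_{/Q}`
  have hδ : (Over.homMk (prod.lift prod.fst (prod.fst ≫ Q.arrow)) (by
          change prod.lift prod.fst (prod.fst ≫ _) ≫ (prod.lift prod.fst (𝟙 _) ≫ prod.fst) =
            prod.lift prod.fst (𝟙 _) ≫ prod.fst
          rw [prod.lift_fst, prod.lift_fst]) :
        (Over.star (Q : 𝒢.E f)).obj (A.T f) ⟶ (Over.star (Q : 𝒢.E f)).obj (A.T f)) =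
      τ ≫ η ≫ (Over.star (Q : 𝒢.E f)).map Q.arrow := by
    apply Over.OverMorphism.ext
    apply Limits.prod.hom_ext
    · simp [τ, η]
      erw [Category.comp_id]
    · simp [τ, η]
  haveI : GaloisCategory (Shrink.{u₁} (Over (Q : 𝒢.E f))) := A.galoisCategory_eModel ec
  haveI : Subsingleton (G'.obj (eQ.functor.obj (Over.mk (𝟙 (Q : 𝒢.E f))))) :=
    subsingleton_fiber_mkId eQ.functor G'
  rw [hd ec, hδ, Functor.map_comp, Functor.map_comp, FintypeCat.comp_apply]
  exact congrArg _ (Subsingleton.elim _ _)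

/-- The edge tautological point `a‴` lies in the sub-fibre `F_Q(Q × Q → Q) ↪ F_Q(Q × T_e → Q)`, i.e.
in the range of `F_Q(φ_{(e,Q)}^*(Q ↪ T_e))`: `(q ↦ (q, q)) = (diagonal) ≫ (Q × (Q ↪ T_e))`.
[cite: MochizukiSemiAnbd2006, Rem. 2.2.1 p.24] -/
theorem diagPointE_mem_range (ec : A.fibreData.total.Edge)
    (G' : A.coveringGraph.E ec ⥤ FintypeCat.{v₁})
    (t : G'.obj ((Shrink.equivalence (Over ((A.eComp ec).1 : 𝒢.E (A.fibreData.proj.edgeMap ec)))).functor.obj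
      (Over.mk (𝟙 ((A.eComp ec).1 : 𝒢.E (A.fibreData.proj.edgeMap ec)))))) :
    G'.map ((Shrink.equivalence (Over ((A.eComp ec).1 : 𝒢.E (A.fibreData.proj.edgeMap ec)))).functor.map
        ((Over.forgetAdjStar ((A.eComp ec).1 : 𝒢.E (A.fibreData.proj.edgeMap ec))).unit.app (Over.mk (𝟙 _)) ≫
          (Over.star ((A.eComp ec).1 : 𝒢.E (A.fibreData.proj.edgeMap ec))).map (A.eComp ec).1.arrow)) t ∈
      Set.range (G'.map ((A.coveringHom.φE ec (A.fibreData.proj.edgeMap ec) rfl).pullback.map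
        (A.eComp ec).1.arrow)) := by
  refine ⟨G'.map ((Shrink.equivalence (Over ((A.eComp ec).1 : 𝒢.E (A.fibreData.proj.edgeMap ec)))).functor.map
    ((Over.forgetAdjStar ((A.eComp ec).1 : 𝒢.E (A.fibreData.proj.edgeMap ec))).unit.app (Over.mk (𝟙 _)))) t, ?_⟩
  rw [Functor.map_comp, Functor.map_comp, FintypeCat.comp_apply]
  rfl

/-- **The gluing isomorphism of `φ^* A` carries the vertex tautological point to the edge tautological
point.**  For a level branch `b̃ = (b, Q)` abutting to `ṽ = (v, P)`, a basepoint `F″` of `(𝒢_v)_P`, a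
basepoint `F_Q` of `(𝒢_e)_Q` and a transport `α̃ : b̃^* ⋙ F_Q ≅ F″`:
`F_Q(ψ̃_{b̃})(α̃⁻¹(a″)) = a‴`, where `a″ ∈ F″(P × S_v → P)` and `a‴ ∈ F_Q(Q × T_e → Q)` are the
tautological points (the diagonal endomorphism `d` of `φ^* A` is a morphism of `B(𝒢_A)`, hence
compatible with `ψ̃`, and acts on both fibres as the constant map onto the tautological point).
[cite: MochizukiSemiAnbd2006, Rem. 2.2.1 p.24] -/
theorem map_ψ_diagPoint (bc : A.fibreData.total.Branch) (vc : A.fibreData.total.Vertex)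
    (h : A.coveringGraph.graph.abuts bc = some vc)
    (F'' : A.coveringGraph.V vc ⥤ FintypeCat.{v₁}) [FiberFunctor F'']
    (G' : A.coveringGraph.E (A.coveringGraph.graph.edgeOf bc) ⥤ FintypeCat.{v₁}) [FiberFunctor G']
    (αt : (A.coveringGraph.pull bc vc h).pullback ⋙ G' ≅ F'')
    (tV : F''.obj ((Shrink.equivalence (Over ((A.vComp vc).1 : 𝒢.V (A.fibreData.proj.vertexMap vc)))).functor.obj
      (Over.mk (𝟙 ((A.vComp vc).1 : 𝒢.V (A.fibreData.proj.vertexMap vc))))))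
    (tE : G'.obj ((Shrink.equivalence (Over ((A.eComp (A.coveringGraph.graph.edgeOf bc)).1 :
      𝒢.E (A.fibreData.proj.edgeMap (A.coveringGraph.graph.edgeOf bc))))).functor.obj
      (Over.mk (𝟙 ((A.eComp (A.coveringGraph.graph.edgeOf bc)).1 :
        𝒢.E (A.fibreData.proj.edgeMap (A.coveringGraph.graph.edgeOf bc))))))) :
    G'.map ((A.coveringHom.pullbackFunctor.obj A).ψ bc vc h).hom
        (αt.inv.app ((A.coveringHom.pullbackFunctor.obj A).S vc)
          (F''.map ((Shrink.equivalence (Over ((A.vComp vc).1 : 𝒢.V (A.fibreData.proj.vertexMap vc)))).functor.map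
            ((Over.forgetAdjStar ((A.vComp vc).1 : 𝒢.V (A.fibreData.proj.vertexMap vc))).unit.app (Over.mk (𝟙 _)) ≫
              (Over.star ((A.vComp vc).1 : 𝒢.V (A.fibreData.proj.vertexMap vc))).map (A.vComp vc).1.arrow)) tV)) =
      G'.map ((Shrink.equivalence (Over ((A.eComp (A.coveringGraph.graph.edgeOf bc)).1 :
          𝒢.E (A.fibreData.proj.edgeMap (A.coveringGraph.graph.edgeOf bc))))).functor.map
        ((Over.forgetAdjStar ((A.eComp (A.coveringGraph.graph.edgeOf bc)).1 :
            𝒢.E (A.fibreData.proj.edgeMap (A.coveringGraph.graph.edgeOf bc)))).unit.app (Over.mk (𝟙 _)) ≫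
          (Over.star ((A.eComp (A.coveringGraph.graph.edgeOf bc)).1 :
            𝒢.E (A.fibreData.proj.edgeMap (A.coveringGraph.graph.edgeOf bc)))).map
            (A.eComp (A.coveringGraph.graph.edgeOf bc)).1.arrow)) tE := by
  obtain ⟨d, hdS, hdT⟩ := A.exists_pullbackObj_diagEndo₂
  -- `d_ṽ` fixes the vertex tautological point `a″`
  have h1 := A.map_diagEndo_fS_apply d hdS vc F'' tV
    (F''.map ((Shrink.equivalence (Over ((A.vComp vc).1 : 𝒢.V (A.fibreData.proj.vertexMap vc)))).functor.map
      ((Over.forgetAdjStar ((A.vComp vc).1 : 𝒢.V (A.fibreData.proj.vertexMap vc))).unit.app (Over.mk (𝟙 _)) ≫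
        (Over.star ((A.vComp vc).1 : 𝒢.V (A.fibreData.proj.vertexMap vc))).map (A.vComp vc).1.arrow)) tV)
  -- naturality of `α̃⁻¹` along `d_ṽ`
  have hnat := FunctorToFintypeCat.naturality F'' ((A.coveringGraph.pull bc vc h).pullback ⋙ G') αt.inv
    (d.fS vc)
    (F''.map ((Shrink.equivalence (Over ((A.vComp vc).1 : 𝒢.V (A.fibreData.proj.vertexMap vc)))).functor.map
      ((Over.forgetAdjStar ((A.vComp vc).1 : 𝒢.V (A.fibreData.proj.vertexMap vc))).unit.app (Over.mk (𝟙 _)) ≫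
        (Over.star ((A.vComp vc).1 : 𝒢.V (A.fibreData.proj.vertexMap vc))).map (A.vComp vc).1.arrow)) tV)
  rw [h1] at hnat
  -- `d` is a morphism of `B(𝒢_A)`: compatible with the gluing isomorphism along `b̃`
  have h3 := ConcreteCategory.congr_hom (congrArg (fun f => G'.map f) (d.comm bc vc h))
    (αt.inv.app ((A.coveringHom.pullbackFunctor.obj A).S vc)
      (F''.map ((Shrink.equivalence (Over ((A.vComp vc).1 : 𝒢.V (A.fibreData.proj.vertexMap vc)))).functor.map
        ((Over.forgetAdjStar ((A.vComp vc).1 : 𝒢.V (A.fibreData.proj.vertexMap vc))).unit.app (Over.mk (𝟙 _)) ≫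
          (Over.star ((A.vComp vc).1 : 𝒢.V (A.fibreData.proj.vertexMap vc))).map (A.vComp vc).1.arrow)) tV))
  beta_reduce at h3
  rw [G'.map_comp, G'.map_comp, FintypeCat.comp_apply, FintypeCat.comp_apply] at h3
  -- `d_ẽ` is the constant map onto the edge tautological point `a‴`
  have h4 := A.map_diagEndo_fT_apply d hdT (A.coveringGraph.graph.edgeOf bc) G' tE
    (G'.map ((A.coveringHom.pullbackFunctor.obj A).ψ bc vc h).hom
      (αt.inv.app ((A.coveringHom.pullbackFunctor.obj A).S vc)
        (F''.map ((Shrink.equivalence (Over ((A.vComp vc).1 : 𝒢.V (A.fibreData.proj.vertexMap vc)))).functor.map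
          ((Over.forgetAdjStar ((A.vComp vc).1 : 𝒢.V (A.fibreData.proj.vertexMap vc))).unit.app (Over.mk (𝟙 _)) ≫
            (Over.star ((A.vComp vc).1 : 𝒢.V (A.fibreData.proj.vertexMap vc))).map (A.vComp vc).1.arrow)) tV)))
  exact ((congrArg (fun y => G'.map ((A.coveringHom.pullbackFunctor.obj A).ψ bc vc h).hom y) hnat).trans
    h3).trans h4

end BObj

end SemiGraphOfAnabelioids

end Literature.AnabelianGeometry.SemiGraphs
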